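import Literature.MathematicalPhysics.QuantumLattice.HubbardSliceSymbolBandIncrementChain
import HarnessLib

/-!
# The increment of the slice symbol between two band curves: the LOW-order members of the chain — first and second differences of
# `t ↦ Ψ̂(u t + w t) − Ψ̂(u t)`, every term carrying the piece `w` or one of its derivatives

Topic `MathematicalPhysics/QuantumLattice`; companion of `HubbardSliceSymbolBandIncrementChain` (the order-three member and third differences).  The
mixed master lemma of the weighted `ℓ¹` bounds reads the increment symbol through the discrete Leibniz rule at orders `≤ 3`, so besides the third
differences it needs the sup (`HubbardSliceSymbolXiIncrements.norm_sliceSymbolFnXi_sub_le`: `≤ K₁|w|`) and the FIRST and SECOND differences of the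
increment along the line (Benfatto–Giuliani–Mastropietro 2006, §3 (3.2)–(3.8): the `m`-th frame piece telescoped out of the slice propagator):

* `abs_add_sq_sub_sq_le` — `|(a+a′)² − a²| ≤ |a′|(2|a| + |a′|)`;
* **`norm_sliceSymbolFnXi_incr_deriv1_le`** — `‖Ψ̂′(x+y)(a+a′) − Ψ̂′(x)a‖ ≤ K₂W₀(D₁+W₁) + K₁W₁`;
* **`norm_sliceSymbolFnXi_incr_deriv2_le`** — `‖[Ψ̂″(x+y)(a+a′)² + Ψ̂′(x+y)(b+b′)] − [Ψ̂″(x)a² + Ψ̂′(x)b]‖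
  ≤ K₃W₀(D₁+W₁)² + K₂W₁(2D₁+W₁) + K₂W₀(D₂+W₂) + K₁W₂`;
* **`norm_fwdDiff_sliceSymbolFnXi_incr_le`**, **`norm_fwdDiff_iter_two_sliceSymbolFnXi_incr_le`** — the first/second differences of the increment along
  the line, `≤ δ·[…]`, `≤ δ²·[…]` (`δ ≥ 0`), with `K₁ = (16B₁+16)c/Λ²`, `K₂ = (32B₂+144B₁+128)c/Λ³`, `K₃ = (64B₃+480B₂+1728B₁+1536)c/Λ⁴`.

Everything is proved; no definitions; no named facts.

## Sources

G. Benfatto, A. Giuliani, V. Mastropietro, Ann. Henri Poincaré 7 (2006) 809–898, (2.36aa), §3 (3.2)–(3.8) (`BenfattoGiulianiMastropietro2006`).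
-/

noncomputable section

namespace Literature.MathematicalPhysics.QuantumLattice

open Literature.Probability.LatticeModels Literature.Analysis.Calculus Set Complex

section IncrChainLow

variable {c θ Λ Λ' ω : ℝ}

/-- Elementary: `|(a + a′)² − a²| ≤ |a′|·(2|a| + |a′|)`. [cite: BenfattoGiulianiMastropietro2006, §3 (3.2)] -/
theorem abs_add_sq_sub_sq_le (a a' : ℝ) : |(a + a') ^ 2 - a ^ 2| ≤ |a'| * (2 * |a| + |a'|) := by
  rw [show (a + a') ^ 2 - a ^ 2 = a' * (2 * a + a') by ring, abs_mul]
  refine mul_le_mul_of_nonneg_left ((abs_add_le _ _).trans ?_) (abs_nonneg _)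
  rw [abs_mul, abs_of_pos (by norm_num : (0:ℝ) < 2)]

/-- **Pointwise bound of the first member of the increment chain**: `‖Ψ̂′(x+y)·(a+a′) − Ψ̂′(x)·a‖ ≤ K₂W₀(D₁+W₁) + K₁W₁`
(`|a| ≤ D₁`, `|y| ≤ W₀`, `|a′| ≤ W₁`). [cite: BenfattoGiulianiMastropietro2006, §3 (3.2)] -/
theorem norm_sliceSymbolFnXi_incr_deriv1_le (hΛ : 0 < Λ) (hΛΛ' : Λ ≤ Λ') (hθ : |θ| ≤ Λ / 4) (hc : 0 ≤ c) {B₁ B₂ : ℝ}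
    (hB₁ : ∀ x, |deriv salmhoferCutoff x| ≤ B₁) (hB₂ : ∀ x, |deriv (deriv salmhoferCutoff) x| ≤ B₂)
    {x y a a' : ℝ} {D₁ W₀ W₁ : ℝ} (ha : |a| ≤ D₁) (hy : |y| ≤ W₀) (ha' : |a'| ≤ W₁) :
    ‖sliceSymbolFnXiD1 c θ Λ Λ' ω (x + y) * ((a + a' : ℝ) : ℂ) - sliceSymbolFnXiD1 c θ Λ Λ' ω x * (a : ℂ)‖ ≤
      (32 * B₂ + 144 * B₁ + 128) * c / Λ ^ 3 * W₀ * (D₁ + W₁) + (16 * B₁ + 16) * c / Λ ^ 2 * W₁ := by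
  have hB10 : 0 ≤ B₁ := (abs_nonneg _).trans (hB₁ 0)
  have hB20 : 0 ≤ B₂ := (abs_nonneg _).trans (hB₂ 0)
  set K₁ := (16 * B₁ + 16) * c / Λ ^ 2 with hK₁
  set K₂ := (32 * B₂ + 144 * B₁ + 128) * c / Λ ^ 3 with hK₂
  have k1 : 0 ≤ K₁ := by rw [hK₁]; positivity
  have k2 : 0 ≤ K₂ := by rw [hK₂]; positivity
  have hW0 : 0 ≤ W₀ := (abs_nonneg _).trans hy
  have key : sliceSymbolFnXiD1 c θ Λ Λ' ω (x + y) * ((a + a' : ℝ) : ℂ) - sliceSymbolFnXiD1 c θ Λ Λ' ω x * (a : ℂ) =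
      (sliceSymbolFnXiD1 c θ Λ Λ' ω (x + y) - sliceSymbolFnXiD1 c θ Λ Λ' ω x) * ((a + a' : ℝ) : ℂ) +
        sliceSymbolFnXiD1 c θ Λ Λ' ω x * ((a' : ℝ) : ℂ) := by push_cast; ring
  rw [key]
  have t1 : ‖(sliceSymbolFnXiD1 c θ Λ Λ' ω (x + y) - sliceSymbolFnXiD1 c θ Λ Λ' ω x) * ((a + a' : ℝ) : ℂ)‖ ≤ K₂ * W₀ * (D₁ + W₁) := by
    rw [norm_mul, Complex.norm_real, Real.norm_eq_abs]
    have h1 := norm_sliceSymbolFnXiD1_sub_le (ω := ω) hΛ hΛΛ' hθ hc hB₁ hB₂ x y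
    exact mul_le_mul (h1.trans (mul_le_mul_of_nonneg_left hy k2)) ((abs_add_le _ _).trans (add_le_add ha ha')) (abs_nonneg _)
      (by positivity)
  have t2 : ‖sliceSymbolFnXiD1 c θ Λ Λ' ω x * ((a' : ℝ) : ℂ)‖ ≤ K₁ * W₁ := by
    rw [norm_mul, Complex.norm_real, Real.norm_eq_abs]
    exact mul_le_mul (norm_sliceSymbolFnXiD1_le hΛ hΛΛ' hθ hc hB₁ x) ha' (abs_nonneg _) k1
  exact (norm_add_le _ _).trans (add_le_add t1 t2)

/-- **Pointwise bound of the second member of the increment chain**: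
`‖[Ψ̂″(x+y)(a+a′)² + Ψ̂′(x+y)(b+b′)] − [Ψ̂″(x)a² + Ψ̂′(x)b]‖ ≤ K₃W₀(D₁+W₁)² + K₂W₁(2D₁+W₁) + K₂W₀(D₂+W₂) + K₁W₂`.
[cite: BenfattoGiulianiMastropietro2006, §3 (3.2)] -/
theorem norm_sliceSymbolFnXi_incr_deriv2_le (hΛ : 0 < Λ) (hΛΛ' : Λ ≤ Λ') (hθ : |θ| ≤ Λ / 4) (hc : 0 ≤ c) {B₁ B₂ B₃ : ℝ}
    (hB₁ : ∀ x, |deriv salmhoferCutoff x| ≤ B₁) (hB₂ : ∀ x, |deriv (deriv salmhoferCutoff) x| ≤ B₂)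
    (hB₃ : ∀ x, |deriv (deriv (deriv salmhoferCutoff)) x| ≤ B₃)
    {x y a b a' b' : ℝ} {D₁ D₂ W₀ W₁ W₂ : ℝ} (ha : |a| ≤ D₁) (hb : |b| ≤ D₂) (hy : |y| ≤ W₀) (ha' : |a'| ≤ W₁) (hb' : |b'| ≤ W₂) :
    ‖(sliceSymbolFnXiD2 c θ Λ Λ' ω (x + y) * ((a + a' : ℝ) : ℂ) ^ 2 + sliceSymbolFnXiD1 c θ Λ Λ' ω (x + y) * ((b + b' : ℝ) : ℂ)) -
        (sliceSymbolFnXiD2 c θ Λ Λ' ω x * (a : ℂ) ^ 2 + sliceSymbolFnXiD1 c θ Λ Λ' ω x * (b : ℂ))‖ ≤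
      (64 * B₃ + 480 * B₂ + 1728 * B₁ + 1536) * c / Λ ^ 4 * W₀ * (D₁ + W₁) ^ 2 +
        (32 * B₂ + 144 * B₁ + 128) * c / Λ ^ 3 * (W₁ * (2 * D₁ + W₁)) +
        ((32 * B₂ + 144 * B₁ + 128) * c / Λ ^ 3 * W₀ * (D₂ + W₂) + (16 * B₁ + 16) * c / Λ ^ 2 * W₂) := by
  have hB10 : 0 ≤ B₁ := (abs_nonneg _).trans (hB₁ 0)
  have hB20 : 0 ≤ B₂ := (abs_nonneg _).trans (hB₂ 0)
  have hB30 : 0 ≤ B₃ := (abs_nonneg _).trans (hB₃ 0)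
  set K₁ := (16 * B₁ + 16) * c / Λ ^ 2 with hK₁
  set K₂ := (32 * B₂ + 144 * B₁ + 128) * c / Λ ^ 3 with hK₂
  set K₃ := (64 * B₃ + 480 * B₂ + 1728 * B₁ + 1536) * c / Λ ^ 4 with hK₃
  have k1 : 0 ≤ K₁ := by rw [hK₁]; positivity
  have k2 : 0 ≤ K₂ := by rw [hK₂]; positivity
  have k3 : 0 ≤ K₃ := by rw [hK₃]; positivity
  have hD1 : 0 ≤ D₁ := (abs_nonneg _).trans ha
  have hW0 : 0 ≤ W₀ := (abs_nonneg _).trans hy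
  have hW1 : 0 ≤ W₁ := (abs_nonneg _).trans ha'
  set Ψ₁ := sliceSymbolFnXiD1 c θ Λ Λ' ω with hΨ₁
  set Ψ₂ := sliceSymbolFnXiD2 c θ Λ Λ' ω with hΨ₂
  have key : (Ψ₂ (x + y) * ((a + a' : ℝ) : ℂ) ^ 2 + Ψ₁ (x + y) * ((b + b' : ℝ) : ℂ)) - (Ψ₂ x * (a : ℂ) ^ 2 + Ψ₁ x * (b : ℂ)) =
      ((Ψ₂ (x + y) - Ψ₂ x) * ((a + a' : ℝ) : ℂ) ^ 2 + Ψ₂ x * (((a + a' : ℝ) : ℂ) ^ 2 - (a : ℂ) ^ 2)) +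
        ((Ψ₁ (x + y) - Ψ₁ x) * ((b + b' : ℝ) : ℂ) + Ψ₁ x * ((b' : ℝ) : ℂ)) := by push_cast; ring
  rw [key]
  have nA : ‖((a + a' : ℝ) : ℂ)‖ ≤ D₁ + W₁ := by
    rw [Complex.norm_real, Real.norm_eq_abs]; exact (abs_add_le _ _).trans (add_le_add ha ha')
  have t1 : ‖(Ψ₂ (x + y) - Ψ₂ x) * ((a + a' : ℝ) : ℂ) ^ 2‖ ≤ K₃ * W₀ * (D₁ + W₁) ^ 2 := by
    rw [norm_mul, norm_pow]
    have h1 := norm_sliceSymbolFnXiD2_sub_le (ω := ω) hΛ hΛΛ' hθ hc hB₁ hB₂ hB₃ x y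
    exact mul_le_mul (h1.trans (mul_le_mul_of_nonneg_left hy k3)) (pow_le_pow_left₀ (norm_nonneg _) nA 2) (by positivity)
      (by positivity)
  have t2 : ‖Ψ₂ x * (((a + a' : ℝ) : ℂ) ^ 2 - (a : ℂ) ^ 2)‖ ≤ K₂ * (W₁ * (2 * D₁ + W₁)) := by
    rw [norm_mul, show (((a + a' : ℝ) : ℂ) ^ 2 - (a : ℂ) ^ 2) = (((a + a') ^ 2 - a ^ 2 : ℝ) : ℂ) by push_cast; ring,
      Complex.norm_real, Real.norm_eq_abs]
    refine mul_le_mul (norm_sliceSymbolFnXiD2_le hΛ hΛΛ' hθ hc hB₁ hB₂ x) ((abs_add_sq_sub_sq_le a a').trans ?_) (abs_nonneg _) k2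
    exact mul_le_mul ha' (by linarith) (by positivity) hW1
  have t3 : ‖(Ψ₁ (x + y) - Ψ₁ x) * ((b + b' : ℝ) : ℂ)‖ ≤ K₂ * W₀ * (D₂ + W₂) := by
    rw [norm_mul, Complex.norm_real, Real.norm_eq_abs]
    have h1 := norm_sliceSymbolFnXiD1_sub_le (ω := ω) hΛ hΛΛ' hθ hc hB₁ hB₂ x y
    exact mul_le_mul (h1.trans (mul_le_mul_of_nonneg_left hy k2)) ((abs_add_le _ _).trans (add_le_add hb hb')) (abs_nonneg _)
      (by positivity)
  have t4 : ‖Ψ₁ x * ((b' : ℝ) : ℂ)‖ ≤ K₁ * W₂ := by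
    rw [norm_mul, Complex.norm_real, Real.norm_eq_abs]
    exact mul_le_mul (norm_sliceSymbolFnXiD1_le hΛ hΛΛ' hθ hc hB₁ x) hb' (abs_nonneg _) k1
  exact (norm_add_le _ _).trans (add_le_add ((norm_add_le _ _).trans (add_le_add t1 t2)) ((norm_add_le _ _).trans (add_le_add t3 t4)))

/-- **First difference of the increment along the line**: with `|u₁| ≤ D₁`, `|w| ≤ W₀`, `|w₁| ≤ W₁` everywhere and `δ ≥ 0`,
`‖Δ_δ(Ψ̂∘(u+w) − Ψ̂∘u)(t)‖ ≤ δ·(K₂W₀(D₁+W₁) + K₁W₁)`. [cite: BenfattoGiulianiMastropietro2006, §3 (3.2)] -/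
theorem norm_fwdDiff_sliceSymbolFnXi_incr_le (hΛ : 0 < Λ) (hΛΛ' : Λ ≤ Λ') (hθ : |θ| ≤ Λ / 4) (hc : 0 ≤ c) {B₁ B₂ : ℝ}
    (hB₁ : ∀ x, |deriv salmhoferCutoff x| ≤ B₁) (hB₂ : ∀ x, |deriv (deriv salmhoferCutoff) x| ≤ B₂)
    {u u₁ w w₁ : ℝ → ℝ} (hu : ∀ t, HasDerivAt u (u₁ t) t) (hw : ∀ t, HasDerivAt w (w₁ t) t)
    {D₁ W₀ W₁ : ℝ} (hD₁ : ∀ t, |u₁ t| ≤ D₁) (hW₀ : ∀ t, |w t| ≤ W₀) (hW₁ : ∀ t, |w₁ t| ≤ W₁) {δ : ℝ} (hδ : 0 ≤ δ) (t : ℝ) :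
    ‖fwdDiff δ (fun s => sliceSymbolFnXi c θ Λ Λ' ω (u s + w s) - sliceSymbolFnXi c θ Λ Λ' ω (u s)) t‖ ≤
      δ * ((32 * B₂ + 144 * B₁ + 128) * c / Λ ^ 3 * W₀ * (D₁ + W₁) + (16 * B₁ + 16) * c / Λ ^ 2 * W₁) := by
  set Ψ := sliceSymbolFnXi c θ Λ Λ' ω with hΨ
  set Ψ₁ := sliceSymbolFnXiD1 c θ Λ Λ' ω with hΨ₁
  have hderiv : ∀ s, HasDerivAt (fun s => Ψ (u s + w s) - Ψ (u s)) (Ψ₁ (u s + w s) * ((u₁ s + w₁ s : ℝ) : ℂ) - Ψ₁ (u s) * (u₁ s : ℂ)) s := by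
    intro s
    have hcomp : ∀ {v v₁ : ℝ → ℝ}, (∀ s, HasDerivAt v (v₁ s) s) → HasDerivAt (fun s => Ψ (v s)) (Ψ₁ (v s) * (v₁ s : ℂ)) s := by
      intro v v₁ hv
      have h := (hasDerivAt_sliceSymbolFnXi (c := c) (ω := ω) hΛ hΛΛ' hθ (v s)).scomp s (hv s)
      have e : (v₁ s) • Ψ₁ (v s) = Ψ₁ (v s) * (v₁ s : ℂ) := by rw [Complex.real_smul, mul_comm]
      rw [e] at h; exact h
    have hA := hcomp (v := fun s => u s + w s) (v₁ := fun s => u₁ s + w₁ s) (fun s => (hu s).add (hw s))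
    have hB := hcomp hu
    exact hA.sub hB
  set G : ℕ → ℝ → ℂ := fun k s =>
      if k = 0 then Ψ (u s + w s) - Ψ (u s)
      else if k = 1 then Ψ₁ (u s + w s) * ((u₁ s + w₁ s : ℝ) : ℂ) - Ψ₁ (u s) * (u₁ s : ℂ)
      else 0 with hG
  have h := Literature.Analysis.norm_fwdDiff_iter_le_of_hasDerivAt hδ 1 G t
    ((32 * B₂ + 144 * B₁ + 128) * c / Λ ^ 3 * W₀ * (D₁ + W₁) + (16 * B₁ + 16) * c / Λ ^ 2 * W₁)
    (fun k hk s _ => by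
      interval_cases k
      show HasDerivAt (fun s => Ψ (u s + w s) - Ψ (u s)) (Ψ₁ (u s + w s) * ((u₁ s + w₁ s : ℝ) : ℂ) - Ψ₁ (u s) * (u₁ s : ℂ)) s
      exact hderiv s)
    (fun s _ => by
      show ‖G 1 s‖ ≤ _
      have : G 1 s = Ψ₁ (u s + w s) * ((u₁ s + w₁ s : ℝ) : ℂ) - Ψ₁ (u s) * (u₁ s : ℂ) := by simp [hG]
      rw [this]
      exact norm_sliceSymbolFnXi_incr_deriv1_le hΛ hΛΛ' hθ hc hB₁ hB₂ (hD₁ s) (hW₀ s) (hW₁ s))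
  have h0 : G 0 = fun s => Ψ (u s + w s) - Ψ (u s) := by funext s; simp [hG]
  rw [h0, Function.iterate_one, pow_one] at h
  exact h

/-- **Second difference of the increment along the line**: with `|u₁| ≤ D₁`, `|u₂| ≤ D₂`, `|w| ≤ W₀`, `|w₁| ≤ W₁`, `|w₂| ≤ W₂` everywhere and `δ ≥ 0`,
`‖Δ_δ²(Ψ̂∘(u+w) − Ψ̂∘u)(t)‖ ≤ δ²·(K₃W₀(D₁+W₁)² + K₂W₁(2D₁+W₁) + K₂W₀(D₂+W₂) + K₁W₂)`. [cite: BenfattoGiulianiMastropietro2006, §3 (3.2)] -/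
theorem norm_fwdDiff_iter_two_sliceSymbolFnXi_incr_le (hΛ : 0 < Λ) (hΛΛ' : Λ ≤ Λ') (hθ : |θ| ≤ Λ / 4) (hc : 0 ≤ c) {B₁ B₂ B₃ : ℝ}
    (hB₁ : ∀ x, |deriv salmhoferCutoff x| ≤ B₁) (hB₂ : ∀ x, |deriv (deriv salmhoferCutoff) x| ≤ B₂)
    (hB₃ : ∀ x, |deriv (deriv (deriv salmhoferCutoff)) x| ≤ B₃)
    {u u₁ u₂ w w₁ w₂ : ℝ → ℝ} (hu : ∀ t, HasDerivAt u (u₁ t) t) (hu₁ : ∀ t, HasDerivAt u₁ (u₂ t) t)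
    (hw : ∀ t, HasDerivAt w (w₁ t) t) (hw₁ : ∀ t, HasDerivAt w₁ (w₂ t) t)
    {D₁ D₂ W₀ W₁ W₂ : ℝ} (hD₁ : ∀ t, |u₁ t| ≤ D₁) (hD₂ : ∀ t, |u₂ t| ≤ D₂) (hW₀ : ∀ t, |w t| ≤ W₀) (hW₁ : ∀ t, |w₁ t| ≤ W₁)
    (hW₂ : ∀ t, |w₂ t| ≤ W₂) {δ : ℝ} (hδ : 0 ≤ δ) (t : ℝ) :
    ‖(fwdDiff δ)^[2] (fun s => sliceSymbolFnXi c θ Λ Λ' ω (u s + w s) - sliceSymbolFnXi c θ Λ Λ' ω (u s)) t‖ ≤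
      δ ^ 2 * ((64 * B₃ + 480 * B₂ + 1728 * B₁ + 1536) * c / Λ ^ 4 * W₀ * (D₁ + W₁) ^ 2 +
        (32 * B₂ + 144 * B₁ + 128) * c / Λ ^ 3 * (W₁ * (2 * D₁ + W₁)) +
        ((32 * B₂ + 144 * B₁ + 128) * c / Λ ^ 3 * W₀ * (D₂ + W₂) + (16 * B₁ + 16) * c / Λ ^ 2 * W₂)) := by
  set Ψ := sliceSymbolFnXi c θ Λ Λ' ω with hΨ
  set Ψ₁ := sliceSymbolFnXiD1 c θ Λ Λ' ω with hΨ₁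
  set Ψ₂ := sliceSymbolFnXiD2 c θ Λ Λ' ω with hΨ₂
  set Ψ₃ := sliceSymbolFnXiD3 c θ Λ Λ' ω with hΨ₃
  -- the first two links of the increment chain, built directly (no third derivatives of `u`, `w` are needed)
  have hcomp : ∀ {f f' : ℝ → ℂ} {v v₁ : ℝ → ℝ}, (∀ x, HasDerivAt f (f' x) x) → (∀ s, HasDerivAt v (v₁ s) s) →
      ∀ s, HasDerivAt (fun s => f (v s)) (f' (v s) * (v₁ s : ℂ)) s := by
    intro f f' v v₁ hf hv s
    have h := (hf (v s)).scomp s (hv s)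
    have e : (v₁ s) • f' (v s) = f' (v s) * (v₁ s : ℂ) := by rw [Complex.real_smul, mul_comm]
    rw [e] at h; exact h
  have hc' : ∀ {v v' : ℝ → ℝ}, (∀ s, HasDerivAt v (v' s) s) → ∀ s, HasDerivAt (fun s => (v s : ℂ)) ((v' s : ℂ)) s :=
    fun h s => HasDerivAt.ofReal_comp (h s)
  have hΨd : ∀ x, HasDerivAt Ψ (Ψ₁ x) x := fun x => hasDerivAt_sliceSymbolFnXi hΛ hΛΛ' hθ x
  have hΨ₁d : ∀ x, HasDerivAt Ψ₁ (Ψ₂ x) x := fun x => hasDerivAt_sliceSymbolFnXiD1 hΛ hΛΛ' hθ x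
  set G : ℕ → ℝ → ℂ := fun k s =>
      if k = 0 then Ψ (u s + w s) - Ψ (u s)
      else if k = 1 then Ψ₁ (u s + w s) * ((u₁ s + w₁ s : ℝ) : ℂ) - Ψ₁ (u s) * (u₁ s : ℂ)
      else if k = 2 then (Ψ₂ (u s + w s) * ((u₁ s + w₁ s : ℝ) : ℂ) ^ 2 + Ψ₁ (u s + w s) * ((u₂ s + w₂ s : ℝ) : ℂ)) -
        (Ψ₂ (u s) * (u₁ s : ℂ) ^ 2 + Ψ₁ (u s) * (u₂ s : ℂ))
      else 0 with hG
  have hv : ∀ s, HasDerivAt (fun s => u s + w s) (u₁ s + w₁ s) s := fun s => (hu s).add (hw s)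
  have hv₁ : ∀ s, HasDerivAt (fun s => u₁ s + w₁ s) (u₂ s + w₂ s) s := fun s => (hu₁ s).add (hw₁ s)
  have hchain : ∀ k < 2, ∀ s, HasDerivAt (G k) (G (k + 1) s) s := by
    intro k hk s
    interval_cases k
    · show HasDerivAt (fun s => Ψ (u s + w s) - Ψ (u s)) (Ψ₁ (u s + w s) * ((u₁ s + w₁ s : ℝ) : ℂ) - Ψ₁ (u s) * (u₁ s : ℂ)) s
      exact (hcomp hΨd hv s).sub (hcomp hΨd hu s)
    · show HasDerivAt (fun s => Ψ₁ (u s + w s) * ((u₁ s + w₁ s : ℝ) : ℂ) - Ψ₁ (u s) * (u₁ s : ℂ))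
        ((Ψ₂ (u s + w s) * ((u₁ s + w₁ s : ℝ) : ℂ) ^ 2 + Ψ₁ (u s + w s) * ((u₂ s + w₂ s : ℝ) : ℂ)) -
          (Ψ₂ (u s) * (u₁ s : ℂ) ^ 2 + Ψ₁ (u s) * (u₂ s : ℂ))) s
      have hA := ((hcomp hΨ₁d hv s).mul (hc' hv₁ s))
      have hB := ((hcomp hΨ₁d hu s).mul (hc' hu₁ s))
      refine (hA.sub hB).congr_deriv ?_
      push_cast
      ring
  have h := Literature.Analysis.norm_fwdDiff_iter_le_of_hasDerivAt hδ 2 G t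
    ((64 * B₃ + 480 * B₂ + 1728 * B₁ + 1536) * c / Λ ^ 4 * W₀ * (D₁ + W₁) ^ 2 +
        (32 * B₂ + 144 * B₁ + 128) * c / Λ ^ 3 * (W₁ * (2 * D₁ + W₁)) +
        ((32 * B₂ + 144 * B₁ + 128) * c / Λ ^ 3 * W₀ * (D₂ + W₂) + (16 * B₁ + 16) * c / Λ ^ 2 * W₂))
    (fun k hk s _ => hchain k hk s)
    (fun s _ => by
      show ‖G 2 s‖ ≤ _
      have : G 2 s = (Ψ₂ (u s + w s) * ((u₁ s + w₁ s : ℝ) : ℂ) ^ 2 + Ψ₁ (u s + w s) * ((u₂ s + w₂ s : ℝ) : ℂ)) -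
          (Ψ₂ (u s) * (u₁ s : ℂ) ^ 2 + Ψ₁ (u s) * (u₂ s : ℂ)) := by simp [hG]
      rw [this]
      exact norm_sliceSymbolFnXi_incr_deriv2_le hΛ hΛΛ' hθ hc hB₁ hB₂ hB₃ (hD₁ s) (hD₂ s) (hW₀ s) (hW₁ s) (hW₂ s))
  have h0 : G 0 = fun s => Ψ (u s + w s) - Ψ (u s) := by funext s; simp [hG]
  rw [h0] at h
  exact h

end IncrChainLow

end Literature.MathematicalPhysics.QuantumLattice

end
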